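import Literature.MathematicalPhysics.QuantumFieldTheory.Balaban1983to89.B16NodeKnitRecord13CoPH
import Summits.QuantumFields.YangMills.Theorems.BalabanUVNodesN11Thm2Ineq249AtRecord13CoPH

/-!
# BalabanUVNodes ∕ N13 — THE N11 → N13 JUNCTION OF [III] COR. 3 (p. 264) AT NODE 00's STAGE-13 RECORD: the Cor.-3 chain's END theorem with its
# effective-action binders in the ASYMMETRIC shape Theorem 2 can serve — (2.49) UPPER half at every configuration, LOWER half only on the support of
# `χ_k` — and the upper half PRODUCED BY NAME from dag-n11-w2's «Theorem 2 at the record» (`…N11Thm2Ineq249AtRecord13CoPH`) at the background of record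
# `U_k(V)` (Track A, DAG node N13 = [B16]; edge N11 → N13; cluster K1 — K1⁷ `StabilityBAtRecordR13SepCoPH` = stmt-QuantumFields-20542, helper; seat
# `pub-ymgap-dag-n13-w3` g0, plan g79 REBALANCE № 5 «§n11 item 2: [B14] Thm 2 p.263 ∕ Cor 3 p.264 at the record BY NAME», CONSUMER cut; 2026-08-28; count-neutral)

HONEST FRAMING.  Count-neutral kernel BOOKKEEPING over landed theorems; nothing of Bałaban's is asserted; [III] Theorem 2 and Corollary 3 are NOT proved — Theorem 2's
sentences and every analytic input of the Cor.-3 chain stay DISPLAYED HYPOTHESES; N11 ∕ N13 are NOT discharged; K0⁷ ∕ K1⁷ NOT closed; counts unmoved (discharged 5∕27 · Track A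
5∕28).  The Yang–Mills mass gap (Clay) is NOT proved by any of this; rung R4 `BalabanLadder.UV` (conditional finite-𝕋⁴ bookkeeping) is the only thing the K-items close.
ONE finite four-torus programme at fixed `ε = L^{-K}`; nothing continuum ∕ ℝ⁴ ∕ OS.  No `sorry`, `def`, `instance`, `notation`.

THE LOCATED CURRENCY POINT (why this file).  N13's record-level END theorem `B16NodeKnitRecord13CoPH.uvIneq_at_record₁₃CoPH_of_gas` (module 36's §4 at the v1.7 `CoPH`
objects) reads [III] Theorem 2 through `B16Cor3ActionBounds.uvIneq_of_repr172_torus_of_ineq249`, whose binder `h249 : ∀ V, Ineq249 (R.A′ V) ((1∕g_k²)·A(U_k(V))) (logT V) C Γ k`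
asks (2.49) **TWO-SIDED at EVERY configuration in CONSTANT-coupling currency** — although the chain's own base `B16Cor3Torus.uvIneq_of_repr172_torus` needs only
`hA′up : ∀ V, A′(V) ≤ E′·|T|` and `hA′ : ∀ V, χ_k(V) ≠ 0 → −(1∕g_k²)A(U_k(V)) − E₁|T| ≤ A′(V)` (lower half ON THE SUPPORT of the all-small characteristic function; the guarded
shape n21-b's `B16Cor3ActionBounds.hA'_of_ineq249` already has).  [III] Theorem 2 at the record, as dag-n11-w2 typed it (`…N11Thm2Ineq249AtRecord13CoPH`, p583777 ✓), is two-sided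
in the SMEARED-coupling currency `A(1∕g_k²(·), U)` of (2.23)–(2.24); in constant-coupling currency it yields the UPPER half at every configuration
(`action23_at_record₁₃CoPH_le_of_thm2`, via (2.24) `1∕g_k² ≤ 1∕g_k²(x)`) and BOTH halves only where every cut-off `φ_j ≡ 1` — the all-small history, p. 259 «g_j²(x) = g_j² on the last
domain» — which is exactly where print uses the lower half (the term without large-field regions, p. 391).  So the edge N11 → N13 is served in the ASYMMETRIC shape and not in
`h249`'s.  THIS FILE: §1 the two scalar bookkeeping steps from the half-inequalities (and that the symmetric `Ineq249` implies both — a weakening, never a strengthening; the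
smeared ↦ constant currency step); §2 the run-level one call `uvIneq_of_repr172_torus_of_ineq249Asym(_of_gas)` (= n21-b's ∕ n14-b's packaging with `h249`, `hlog` replaced by
`h249up` at every `V` and `h249low`, `hlog` ON THE SUPPORT of `χ_k`); §3 the construction-level and the RECORD-level END twins (`uvIneq_at_record₁₃CoPH_of_gas_asym`, core-keyed
datum `datumOfRecord₁₃CoPH`, hence every proviso edition incl. v1.7 `SepCoPH` by def-T's `rfl` bridge; `hA0` discharged by `wilsonBGOfRecord_nonneg`); §4 THE JUNCTION BY NAME: at a
configuration `V`, dag-n11-w2's `action23_at_record₁₃CoPH_le_of_thm2` evaluated AT THE BACKGROUND OF RECORD `U := Node00.Uk F N P.K k θ.εbg V` (so that its Wilson term IS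
`(1∕g_k²)·wilsonBGOfRecord F N θ.εbg P k V`, `rfl`) produces the `h249up` inequality at `V` with `logT V := −EkLog`, `C := E₁(1−L^{−β})⁻¹ + 1 + 2B₁ + E₂`, UNDER ONE DISPLAYED
IDENTIFICATION `hA'eq : R.A′ V = (sect2ActionDataOfRecord … s t a E_k).action23 k (U_k(V))` — «the (1.72) representation's completed action IS print's (2.23) action of record at the
background of `V` along the history `s`» — the object-level seam that stays open (WHAT the (1.72) representation `R` of `densOfRecord₁₃` IS: the K0∕XL core, not claimed here).
The LOWER half on the support and the log-term sizes (`hlog`, `hlog′`: [V] (1.10), `B16Cor3ActionBounds.abs_Ek110_le`) and the volume majorant `hΓ` stay displayed.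

Sources: [Balaban1989LargeFieldII] Thm 1 p.355, (0.1) pp.355–356, (1.72) p.379, (1.73) p.380, p.387, p.391; [Balaban1988Convergent] Thm 2 (2.43)–(2.44) p.263, (2.45)–(2.50)
pp.263–264, (2.23)–(2.24) pp.258–259, p.259; [Balaban1985LargeFieldV = V] (1.10) p.358 (log terms, via n21-b's module; bookkeeping only here).
-/

noncomputable section

open MeasureTheory
open scoped BigOperators Matrix.Norms.L2Operator

namespace Summit.QuantumFields.YangMills.BalabanUVNodes.N13Cor3AsymJunctionAtRecord13CoPH

open Literature.MathematicalPhysics.QuantumFieldTheory.Balaban1983to89 Step B14.Eq225Concrete B14.LocalCoupling B14Thm2 Finset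
open T4Continuum T4DatumAssembly Node00 DagBinding FlowStepRuns
open B16Cor3Ops (Repr172)
open TreeLengthTorus (tsys)
open B13FamilySum (Ineq126 VolBound)
open B16Eq190Resummation (bracket mayerTerm F191 polys190 LocalOps DepOn)
open Summit.QuantumFields.YangMills.Theorems.BalabanUVNodesN11Thm2Ineq249AtRecord13CoPH (action23_at_record₁₃CoPH_le_of_thm2)

/-! ## §1. Scalars: the two halves of (2.49) and what each yields; symmetric ⇒ asymmetric; smeared ⇒ constant currency -/

section Scalars

variable {Ak Awil logT C N cΓ cL cL' : ℝ} {Γ : ℕ → ℝ} {k : ℕ}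

/-- UPPER (2.49) half `A_k + A_wil − logT ≤ C·ΣΓ` with the volume majorant, `C ≥ 0`, `logT ≤ c_L′·N` and `0 ≤ A_wil` ⇒ `A_k ≤ (C·c_Γ + c_L′)·N` (n21-b's `aPrime_upper_of_ineq249`
from the upper half alone). [cite: Balaban1988Convergent, (2.49)–(2.50) p.264 (bookkeeping)] -/
theorem aPrime_upper_of_ineq249up (hup : Ak + Awil - logT ≤ C * ∑ n ∈ Icc 1 k, Γ n)
    (hΓ : ∑ n ∈ Icc 1 k, Γ n ≤ cΓ * N) (hC : 0 ≤ C) (hlog' : logT ≤ cL' * N) (hA : 0 ≤ Awil) :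
    Ak ≤ (C * cΓ + cL') * N := by
  have h2 : C * ∑ n ∈ Icc 1 k, Γ n ≤ C * (cΓ * N) := mul_le_mul_of_nonneg_left hΓ hC
  nlinarith

/-- LOWER (2.49) half `−C·ΣΓ ≤ A_k + A_wil − logT` with the volume majorant, `C ≥ 0` and `−c_L·N ≤ logT` ⇒ `−A_wil − (C·c_Γ + c_L)·N ≤ A_k` (n21-b's `aPrime_lower_of_ineq249` from
the lower half alone). [cite: Balaban1988Convergent, (2.49)–(2.50) p.264 (bookkeeping)] -/
theorem aPrime_lower_of_ineq249low (hlow : -(C * ∑ n ∈ Icc 1 k, Γ n) ≤ Ak + Awil - logT)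
    (hΓ : ∑ n ∈ Icc 1 k, Γ n ≤ cΓ * N) (hC : 0 ≤ C) (hlog : -(cL * N) ≤ logT) :
    -Awil - (C * cΓ + cL) * N ≤ Ak := by
  have h2 : C * ∑ n ∈ Icc 1 k, Γ n ≤ C * (cΓ * N) := mul_le_mul_of_nonneg_left hΓ hC
  nlinarith

/-- The symmetric `Ineq249` gives the upper half (a WEAKENING of the chain's binder, never a strengthening). [cite: Balaban1988Convergent, (2.49) p.264 (bookkeeping)] -/
theorem ineq249up_of_ineq249 (h : Ineq249 Ak Awil logT C Γ k) : Ak + Awil - logT ≤ C * ∑ n ∈ Icc 1 k, Γ n :=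
  (abs_le.mp h).2

/-- The symmetric `Ineq249` gives the lower half. [cite: Balaban1988Convergent, (2.49) p.264 (bookkeeping)] -/
theorem ineq249low_of_ineq249 (h : Ineq249 Ak Awil logT C Γ k) : -(C * ∑ n ∈ Icc 1 k, Γ n) ≤ Ak + Awil - logT :=
  (abs_le.mp h).1

/-- The two halves together ARE `Ineq249`. [cite: Balaban1988Convergent, (2.49) p.264 (bookkeeping)] -/
theorem ineq249_of_up_of_low (hup : Ak + Awil - logT ≤ C * ∑ n ∈ Icc 1 k, Γ n) (hlow : -(C * ∑ n ∈ Icc 1 k, Γ n) ≤ Ak + Awil - logT) :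
    Ineq249 Ak Awil logT C Γ k :=
  abs_le.mpr ⟨hlow, hup⟩

/-- **SMEARED ⇒ CONSTANT CURRENCY, UPPER HALF**: the upper (2.49) in the smeared-coupling currency `A(1∕g_k²(·), U)` plus (2.24)'s `(1∕g_k²)·A(U) ≤ A(1∕g_k²(·), U)` (dag-n11-w2's
`const_wilson_le_smearedWilson_invSq` shape, displayed as `hcs`) gives the upper half in constant-coupling currency. [cite: Balaban1988Convergent, (2.24) p.259, (2.49) p.264 (bookkeeping)] -/
theorem ineq249up_const_of_smeared {Asm Acst : ℝ} (hup : Ak + Asm - logT ≤ C * ∑ n ∈ Icc 1 k, Γ n) (hcs : Acst ≤ Asm) :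
    Ak + Acst - logT ≤ C * ∑ n ∈ Icc 1 k, Γ n := by
  linarith

/-- **SMEARED = CONSTANT ON THE ALL-SMALL HISTORY**: where `A(1∕g_k²(·), U) = (1∕g_k²)·A(U)` (every cut-off `φ_j ≡ 1`, p. 259; dag-n11-w2's `smearedWilson_invSq_eq_const_of_phi_eq_one`
shape, displayed as `heq`) the two-sided smeared (2.49) IS the two-sided constant-currency one. [cite: Balaban1988Convergent, p.259, (2.49) p.264 (bookkeeping)] -/
theorem ineq249_const_of_smeared_of_eq {Asm Acst : ℝ} (h : Ineq249 Ak Asm logT C Γ k) (heq : Asm = Acst) : Ineq249 Ak Acst logT C Γ k :=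
  heq ▸ h

end Scalars

/-! ## §2. Run level: the Cor.-3 chain's torus one call with ASYMMETRIC effective-action binders -/

section Run

variable (D : B16.RunData) (k : ℕ)

/-- `hA′up` PRODUCED from the UPPER (2.49) half at every configuration, the volume majorant, the upper log-term bound and `0 ≤ A(U_k(V))`.
[cite: Balaban1988Convergent, (2.49)–(2.50) p.264 (bookkeeping)] -/
theorem hA'up_of_ineq249up (A' : D.Cfg k → ℝ) (logT : D.Cfg k → ℝ) {C cΓ cL' : ℝ} {Γ : ℕ → ℝ}
    (hC : 0 ≤ C) (hΓ : ∑ n ∈ Icc 1 k, Γ n ≤ cΓ * (D.numSites k : ℝ))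
    (h249up : ∀ V, A' V + 1 / (D.flow.g k) ^ 2 * D.wilsonBG k V - logT V ≤ C * ∑ n ∈ Icc 1 k, Γ n)
    (hlog' : ∀ V, logT V ≤ cL' * (D.numSites k : ℝ)) (hA0 : ∀ V, 0 ≤ D.wilsonBG k V) :
    ∀ V, A' V ≤ (C * cΓ + cL') * (D.numSites k : ℝ) :=
  fun V => aPrime_upper_of_ineq249up (h249up V) hΓ hC (hlog' V) (by have := hA0 V; positivity)

/-- `hA′` PRODUCED from the LOWER (2.49) half ON THE SUPPORT of `χ_k`, the volume majorant and the lower log-term bound on the support.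
[cite: Balaban1988Convergent, (2.49)–(2.50) p.264 (bookkeeping)] -/
theorem hA'_of_ineq249low (A' : D.Cfg k → ℝ) (logT : D.Cfg k → ℝ) {C cΓ cL : ℝ} {Γ : ℕ → ℝ}
    (hC : 0 ≤ C) (hΓ : ∑ n ∈ Icc 1 k, Γ n ≤ cΓ * (D.numSites k : ℝ))
    (h249low : ∀ V, D.χ k V ≠ 0 → -(C * ∑ n ∈ Icc 1 k, Γ n) ≤ A' V + 1 / (D.flow.g k) ^ 2 * D.wilsonBG k V - logT V)
    (hlog : ∀ V, D.χ k V ≠ 0 → -(cL * (D.numSites k : ℝ)) ≤ logT V) :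
    ∀ V, D.χ k V ≠ 0 → -(1 / (D.flow.g k) ^ 2 * D.wilsonBG k V) - (C * cΓ + cL) * (D.numSites k : ℝ) ≤ A' V :=
  fun V hV => aPrime_lower_of_ineq249low (h249low V hV) hΓ hC (hlog V hV)

/-- **THE TORUS ONE CALL OF THE COR.-3 CHAIN WITH ASYMMETRIC (2.49) BINDERS** — n21-b's `B16Cor3ActionBounds.uvIneq_of_repr172_torus_of_ineq249` with `h249`∕`hlog` REPLACED by
`h249up` (upper half, every `V`) and `h249low`∕`hlog` (lower half and lower log bound ON THE SUPPORT of `χ_k`); every other binder ((1.72) datum `hH`, χ dictionary, factor leaves,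
curly bracket, site count, `hA0`) verbatim; same constants `E₋ = C·c_Γ + c_L + ε`, `E₊ = C·c_Γ + c_L′ + ε′ + M⁻⁴·K₀(64,8)·Σ_i e^{−c_i}`.  Directly over the base
`B16Cor3Torus.uvIneq_of_repr172_torus`.  CONDITIONAL on every input. [cite: Balaban1989LargeFieldII, (0.1) p.356, p.387 after (1.89), p.391; Balaban1988Convergent, (2.49)–(2.50) p.264] -/
theorem uvIneq_of_repr172_torus_of_ineq249Asym (N : ℕ) [NeZero N] (R : Repr172 (D.Cfg k) (tsys 4 N).Dom)
    {M : ℝ} (hM : M ≠ 0) (hnum : (D.numSites k : ℝ) = (M * N) ^ 4)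
    {κ₁ : ℝ} (hκ : B12TreeDecay.kappa₀ (4 * 2 ^ 4) (2 * 4) ≤ κ₁)
    (c : Fin 2 → ℝ) (Rre : D.Cfg k → ℝ) (ε ε' : ℝ)
    (hH : R.Holds (D.ρ k))
    (hχ01 : ∀ a V, 0 ≤ R.χ a V ∧ R.χ a V ≤ 1)
    (h0χ : ∀ V, R.χ R.allSmall V = D.χ k V)
    (hZ : ∀ a V, (R.TZ a).T 1 V ≤ ∏ X ∈ R.Zc a, Real.exp (-(c 0) - κ₁ * (tsys 4 N).dj X))
    (hY : ∀ a V, (R.TYs a).T 1 V ≤ ∏ Y ∈ R.Ys a, Real.exp (-(c 1) - κ₁ * (tsys 4 N).dj Y))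
    (hcurly : ∀ a V, 0 ≤ R.curly a V ∧ R.curly a V ≤ Real.exp (ε' * (D.numSites k : ℝ)))
    (h0c : ∀ V, R.curly R.allSmall V = Real.exp (Rre V))
    (hR : ∀ V, |Rre V| ≤ ε * (D.numSites k : ℝ))
    (logT : D.Cfg k → ℝ) {C cΓ cL cL' : ℝ} {Γ : ℕ → ℝ} (hC : 0 ≤ C)
    (hΓ : ∑ n ∈ Icc 1 k, Γ n ≤ cΓ * (D.numSites k : ℝ))
    (h249up : ∀ V, R.A' V + 1 / (D.flow.g k) ^ 2 * D.wilsonBG k V - logT V ≤ C * ∑ n ∈ Icc 1 k, Γ n)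
    (h249low : ∀ V, D.χ k V ≠ 0 → -(C * ∑ n ∈ Icc 1 k, Γ n) ≤ R.A' V + 1 / (D.flow.g k) ^ 2 * D.wilsonBG k V - logT V)
    (hlog : ∀ V, D.χ k V ≠ 0 → -(cL * (D.numSites k : ℝ)) ≤ logT V) (hlog' : ∀ V, logT V ≤ cL' * (D.numSites k : ℝ))
    (hA0 : ∀ V, 0 ≤ D.wilsonBG k V) :
    ∀ V : D.Cfg k, B16.UVIneq D k V (C * cΓ + cL + ε)
      (C * cΓ + cL' + ε' + M⁻¹ ^ 4 * B12TreeDecay.K₀ (4 * 2 ^ 4) (2 * 4) * ∑ i, Real.exp (-(c i))) :=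
  B16Cor3Torus.uvIneq_of_repr172_torus D k N R hM hnum hκ c Rre (C * cΓ + cL) ε ε' (C * cΓ + cL') hH hχ01 h0χ hZ hY
    (hA'up_of_ineq249up D k R.A' logT hC hΓ h249up hlog' hA0) hcurly h0c hR
    (hA'_of_ineq249low D k R.A' logT hC hΓ h249low hlog)

/-- The symmetric packaging IS a special case: n21-b's binders `h249` (two-sided, every `V`) and `hlog` (every `V`) give `h249up`, `h249low`, `hlog`-on-the-support — so
`uvIneq_of_repr172_torus_of_ineq249Asym` asks no more than `B16Cor3ActionBounds.uvIneq_of_repr172_torus_of_ineq249`. [cite: Balaban1988Convergent, (2.49) p.264 (bookkeeping)] -/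
theorem asymBinders_of_ineq249 {Dom : Type*} (R : Repr172 (D.Cfg k) Dom) (logT : D.Cfg k → ℝ) {C cL : ℝ} {Γ : ℕ → ℝ}
    (h249 : ∀ V, Ineq249 (R.A' V) (1 / (D.flow.g k) ^ 2 * D.wilsonBG k V) (logT V) C Γ k)
    (hlog : ∀ V, -(cL * (D.numSites k : ℝ)) ≤ logT V) :
    (∀ V, R.A' V + 1 / (D.flow.g k) ^ 2 * D.wilsonBG k V - logT V ≤ C * ∑ n ∈ Icc 1 k, Γ n) ∧
      (∀ V, D.χ k V ≠ 0 → -(C * ∑ n ∈ Icc 1 k, Γ n) ≤ R.A' V + 1 / (D.flow.g k) ^ 2 * D.wilsonBG k V - logT V) ∧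
      (∀ V, D.χ k V ≠ 0 → -(cL * (D.numSites k : ℝ)) ≤ logT V) :=
  ⟨fun V => ineq249up_of_ineq249 (h249 V), fun V _ => ineq249low_of_ineq249 (h249 V), fun V _ => hlog V⟩

/-- **… WITH THE CURLY-BRACKET BINDERS FROM THE (1.90) GAS** (n14-b's `B16Cor3CurlyGas.curlyBinders_of_gas` supplies `hcurly`, `h0c`, `hR`): the asymmetric twin of
`B16Cor3CurlyGas.uvIneq_of_repr172_torus_of_ineq249_of_gas`; constants as there with `ε = ε′ = πc·c₁e^{τc_v}K₀`. CONDITIONAL on every input.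
[cite: Balaban1989LargeFieldII, (0.1) p.356, p.387, (1.98) p.390; Balaban1988Convergent, (2.49)–(2.50) p.264] -/
theorem uvIneq_of_repr172_torus_of_ineq249Asym_of_gas (N : ℕ) [NeZero N] (R : Repr172 (D.Cfg k) (tsys 4 N).Dom)
    {M : ℝ} (hM : M ≠ 0) (hnum : (D.numSites k : ℝ) = (M * N) ^ 4)
    {κ₁ : ℝ} (hκ : B12TreeDecay.kappa₀ (4 * 2 ^ 4) (2 * 4) ≤ κ₁) (c : Fin 2 → ℝ)
    (hH : R.Holds (D.ρ k))
    (hχ01 : ∀ a V, 0 ≤ R.χ a V ∧ R.χ a V ≤ 1)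
    (h0χ : ∀ V, R.χ R.allSmall V = D.χ k V)
    (hZ : ∀ a V, (R.TZ a).T 1 V ≤ ∏ X ∈ R.Zc a, Real.exp (-(c 0) - κ₁ * (tsys 4 N).dj X))
    (hY : ∀ a V, (R.TYs a).T 1 V ≤ ∏ Y ∈ R.Ys a, Real.exp (-(c 1) - κ₁ * (tsys 4 N).dj Y))
    {LF DomY Cube Var Sv : Type*} [Fintype LF] [Fintype DomY] [Fintype Cube] [DecidableEq LF] [DecidableEq DomY]
    [DecidableEq Cube] {adjC : Cube → Cube → Prop} [DecidableRel adjC]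
    (hrefl : ∀ a, adjC a a) (hsymm : ∀ a b, adjC a b → adjC b a)
    {locX : LF → Finset Cube} {locY : DomY → Finset Cube} {site : Var → Cube} (Yfix : R.Adm → Finset Cube)
    (houtX : ∀ a j, (locX j \ Yfix a).Nonempty) (houtY : ∀ a Y, (locY Y \ Yfix a).Nonempty)
    (Op : R.Adm → Finset LF → ((Var → Sv) → ℂ) →+ ((Var → Sv) → ℂ))
    (hOps : ∀ a, LocalOps adjC locX (Yfix a) site (Op a))
    (hOpReal : ∀ a (S : Finset LF) (f : (Var → Sv) → ℂ), (∀ ψ, (f ψ).im = 0) → ∀ φ, (Op a S f φ).im = 0)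
    (Vt : R.Adm → DomY → (Var → Sv) → ℂ) (hV : ∀ a Y, DepOn (Yfix a) site (Vt a Y) (locY Y))
    (hVreal : ∀ a Y ψ, (Vt a Y ψ).im = 0) (cfg : D.Cfg k → (Var → Sv))
    {nbr : Cube → Finset Cube} (hnbr : ∀ a b, adjC a b → a ∈ nbr b) {ν : ℝ} (hν : ∀ b, ((nbr b).card : ℝ) ≤ ν)
    {d : R.Adm → Finset Cube → ℝ} {c₁ Rr κ₀ K₀ cv τ : ℝ} (hd : ∀ a X, 0 ≤ d a X) (hc₁ : 0 ≤ c₁) (hK₀ : 0 ≤ K₀)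
    (hτ : 0 ≤ τ)
    (h197 : ∀ a V X, ‖F191 adjC locX locY (Yfix a) (mayerTerm (Op a) (Vt a) (cfg V)) X‖ ≤ c₁ * Real.exp (-(Rr * d a X)))
    (h126 : ∀ a, Ineq126 (polys190 adjC locX locY (Yfix a)) (fun X => X \ Yfix a) (d a) κ₀ K₀)
    (hvol : ∀ a, VolBound (polys190 adjC locX locY (Yfix a)) (fun X => X \ Yfix a) (d a) cv)
    (hrate : κ₀ + τ * cv ≤ Rr) (hsmall : c₁ * Real.exp (τ * cv) * K₀ * ν ≤ τ)
    (hjunction : ∀ a V, R.curly a V = (bracket (Op a) (Vt a) (cfg V)).re)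
    {πc : ℝ} (hQ : (Fintype.card Cube : ℝ) ≤ πc * (D.numSites k : ℝ))
    (logT : D.Cfg k → ℝ) {C cΓ cL cL' : ℝ} {Γ : ℕ → ℝ} (hC : 0 ≤ C)
    (hΓ : ∑ n ∈ Icc 1 k, Γ n ≤ cΓ * (D.numSites k : ℝ))
    (h249up : ∀ V, R.A' V + 1 / (D.flow.g k) ^ 2 * D.wilsonBG k V - logT V ≤ C * ∑ n ∈ Icc 1 k, Γ n)
    (h249low : ∀ V, D.χ k V ≠ 0 → -(C * ∑ n ∈ Icc 1 k, Γ n) ≤ R.A' V + 1 / (D.flow.g k) ^ 2 * D.wilsonBG k V - logT V)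
    (hlog : ∀ V, D.χ k V ≠ 0 → -(cL * (D.numSites k : ℝ)) ≤ logT V) (hlog' : ∀ V, logT V ≤ cL' * (D.numSites k : ℝ))
    (hA0 : ∀ V, 0 ≤ D.wilsonBG k V) :
    ∀ V : D.Cfg k, B16.UVIneq D k V (C * cΓ + cL + πc * (c₁ * Real.exp (τ * cv) * K₀))
      (C * cΓ + cL' + πc * (c₁ * Real.exp (τ * cv) * K₀) +
        M⁻¹ ^ 4 * B12TreeDecay.K₀ (4 * 2 ^ 4) (2 * 4) * ∑ i, Real.exp (-(c i))) := by
  obtain ⟨Rre, hcurly, h0c, hR⟩ := B16Cor3CurlyGas.curlyBinders_of_gas D k R hrefl hsymm Yfix houtX houtY Op hOps hOpReal Vt hV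
    hVreal cfg hnbr hν hd hc₁ hK₀ hτ h197 h126 hvol hrate hsmall hjunction hQ
  exact uvIneq_of_repr172_torus_of_ineq249Asym D k N R hM hnum hκ c Rre (πc * (c₁ * Real.exp (τ * cv) * K₀))
    (πc * (c₁ * Real.exp (τ * cv) * K₀)) hH hχ01 h0χ hZ hY hcurly h0c hR logT hC hΓ h249up h249low hlog hlog' hA0

end Run

/-! ## §3. The END theorem with asymmetric binders AT A CORE's CONSTRUCTION and AT NODE 00's STAGE-13 RECORD (core-keyed datum `datumOfRecord₁₃CoPH`) -/

section Construction

variable (F : T4Family) (N : ℕ) [NeZero N]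
variable (M : RGMachineCore F (SU N)) (ρ : (p : B12.RunParams) → (k : ℕ) → Density (F.P p.K) k (SU N)) (P : B12.RunParams) (k : ℕ)

/-- **THE COR.-3 CHAIN's END THEOREM AT A CONSTRUCTION, ASYMMETRIC (2.49) BINDERS** (§2 at `D := M.construction ρ P`, every `D`-face by `rfl` — dag-n13-a module 15's
`B16NodeKnitRecord9Cor3.uvIneq_at_construction_of_gas` with `h249`∕`hlog` replaced by `h249up` ∕ `h249low`-on-`{χ_k ≠ 0}` ∕ `hlog`-on-`{χ_k ≠ 0}`).  CONDITIONAL on every input.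
[cite: Balaban1989LargeFieldII, (0.1) p.356, p.387, p.391; Balaban1988Convergent, (2.49)–(2.50) p.264] -/
theorem uvIneq_at_construction_of_gas_asym (Nc : ℕ) [NeZero Nc] (R : Repr172 (GaugeField (F.P P.K) k (SU N)) (tsys 4 Nc).Dom)
    {M₁ : ℝ} (hM : M₁ ≠ 0) (hnum : (Fintype.card (Site (F.P P.K) k) : ℝ) = (M₁ * Nc) ^ 4)
    {κ₁ : ℝ} (hκ : B12TreeDecay.kappa₀ (4 * 2 ^ 4) (2 * 4) ≤ κ₁) (c : Fin 2 → ℝ)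
    (hH : R.Holds (ρ P k))
    (hχ01 : ∀ a V, 0 ≤ R.χ a V ∧ R.χ a V ≤ 1)
    (h0χ : ∀ V, R.χ R.allSmall V = M.χ P k V)
    (hZ : ∀ a V, (R.TZ a).T 1 V ≤ ∏ X ∈ R.Zc a, Real.exp (-(c 0) - κ₁ * (tsys 4 Nc).dj X))
    (hY : ∀ a V, (R.TYs a).T 1 V ≤ ∏ Y ∈ R.Ys a, Real.exp (-(c 1) - κ₁ * (tsys 4 Nc).dj Y))
    {LF DomY Cube Var Sv : Type*} [Fintype LF] [Fintype DomY] [Fintype Cube] [DecidableEq LF] [DecidableEq DomY]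
    [DecidableEq Cube] {adjC : Cube → Cube → Prop} [DecidableRel adjC]
    (hrefl : ∀ a, adjC a a) (hsymm : ∀ a b, adjC a b → adjC b a)
    {locX : LF → Finset Cube} {locY : DomY → Finset Cube} {site : Var → Cube} (Yfix : R.Adm → Finset Cube)
    (houtX : ∀ a j, (locX j \ Yfix a).Nonempty) (houtY : ∀ a Y, (locY Y \ Yfix a).Nonempty)
    (Op : R.Adm → Finset LF → ((Var → Sv) → ℂ) →+ ((Var → Sv) → ℂ))
    (hOps : ∀ a, LocalOps adjC locX (Yfix a) site (Op a))
    (hOpReal : ∀ a (S : Finset LF) (f : (Var → Sv) → ℂ), (∀ ψ, (f ψ).im = 0) → ∀ φ, (Op a S f φ).im = 0)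
    (Vt : R.Adm → DomY → (Var → Sv) → ℂ) (hV : ∀ a Y, DepOn (Yfix a) site (Vt a Y) (locY Y))
    (hVreal : ∀ a Y ψ, (Vt a Y ψ).im = 0) (cfg : GaugeField (F.P P.K) k (SU N) → (Var → Sv))
    {nbr : Cube → Finset Cube} (hnbr : ∀ a b, adjC a b → a ∈ nbr b) {νn : ℝ} (hν : ∀ b, ((nbr b).card : ℝ) ≤ νn)
    {d : R.Adm → Finset Cube → ℝ} {c₁ Rr κ₀ K₀ cv τ : ℝ} (hd : ∀ a X, 0 ≤ d a X) (hc₁ : 0 ≤ c₁) (hK₀ : 0 ≤ K₀)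
    (hτ : 0 ≤ τ)
    (h197 : ∀ a V X, ‖F191 adjC locX locY (Yfix a) (mayerTerm (Op a) (Vt a) (cfg V)) X‖ ≤ c₁ * Real.exp (-(Rr * d a X)))
    (h126 : ∀ a, Ineq126 (polys190 adjC locX locY (Yfix a)) (fun X => X \ Yfix a) (d a) κ₀ K₀)
    (hvol : ∀ a, VolBound (polys190 adjC locX locY (Yfix a)) (fun X => X \ Yfix a) (d a) cv)
    (hrate : κ₀ + τ * cv ≤ Rr) (hsmall : c₁ * Real.exp (τ * cv) * K₀ * νn ≤ τ)
    (hjunction : ∀ a V, R.curly a V = (bracket (Op a) (Vt a) (cfg V)).re)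
    {πc : ℝ} (hQ : (Fintype.card Cube : ℝ) ≤ πc * (Fintype.card (Site (F.P P.K) k) : ℝ))
    (logT : GaugeField (F.P P.K) k (SU N) → ℝ) {CA cΓ cL cL' : ℝ} {Γ : ℕ → ℝ} (hCA : 0 ≤ CA)
    (hΓ : ∑ n ∈ Icc 1 k, Γ n ≤ cΓ * (Fintype.card (Site (F.P P.K) k) : ℝ))
    (h249up : ∀ V, R.A' V + 1 / (genSeq M.βfun P.g0 k) ^ 2 * M.wilsonBG P k V - logT V ≤ CA * ∑ n ∈ Icc 1 k, Γ n)
    (h249low : ∀ V, M.χ P k V ≠ 0 → -(CA * ∑ n ∈ Icc 1 k, Γ n) ≤ R.A' V + 1 / (genSeq M.βfun P.g0 k) ^ 2 * M.wilsonBG P k V - logT V)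
    (hlog : ∀ V, M.χ P k V ≠ 0 → -(cL * (Fintype.card (Site (F.P P.K) k) : ℝ)) ≤ logT V)
    (hlog' : ∀ V, logT V ≤ cL' * (Fintype.card (Site (F.P P.K) k) : ℝ))
    (hA0 : ∀ V, 0 ≤ M.wilsonBG P k V) :
    ∀ V : GaugeField (F.P P.K) k (SU N),
      B16.UVIneq (M.construction ρ P) k V (CA * cΓ + cL + πc * (c₁ * Real.exp (τ * cv) * K₀))
        (CA * cΓ + cL' + πc * (c₁ * Real.exp (τ * cv) * K₀) +
          M₁⁻¹ ^ 4 * B12TreeDecay.K₀ (4 * 2 ^ 4) (2 * 4) * ∑ i, Real.exp (-(c i))) :=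
  uvIneq_of_repr172_torus_of_ineq249Asym_of_gas (M.construction ρ P) k Nc R hM hnum hκ c hH hχ01 h0χ hZ hY hrefl hsymm Yfix houtX
    houtY Op hOps hOpReal Vt hV hVreal cfg hnbr hν hd hc₁ hK₀ hτ h197 h126 hvol hrate hsmall hjunction hQ logT hCA hΓ h249up h249low
    hlog hlog' hA0

end Construction

section AtRecord

variable (F : T4Family) (N : ℕ) [NeZero N]
variable (θ : Stage13HParams F N) (h : θ.Provisos₁₃CoPH F N) (P : B12.RunParams) (k : ℕ)

/-- **★ THE COR.-3 CHAIN's END THEOREM AT NODE 00's STAGE-13 RECORD, ASYMMETRIC (2.49) BINDERS** — module 36 §4's `B16NodeKnitRecord13CoPH.uvIneq_at_record₁₃CoPH_of_gas` with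
`h249` ∕ `hlog` REPLACED by `h249up` (upper half in constant-coupling currency at EVERY `V` — the half [III] Thm 2 serves at the record, §4), `h249low` and `hlog` asked ONLY where
`χ^{(2.9)}_k(V) ≠ 0` (the all-small support, p. 391); at `D := (datumOfRecord₁₃CoPH F N θ h).C P`, `χ_k = chiβOfRecord₁₃`, `A^η_k = wilsonBGOfRecord θ.εbg`, `g_k = gOfRecord₁₃`,
`ρ_k = densOfRecord₁₃`, `|T₁^{(k)}| = |Site (F.P P.K) k|`; `hA0` DISCHARGED by `wilsonBGOfRecord_nonneg`.  Every other binder of module 36 §4 verbatim; same constants.  For EVERY proviso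
edition over the Co background (their datum IS this one by def-T's `rfl` bridges, e.g. `datumOfRecord₁₃SepCoPH_eq_coPH`).  CONDITIONAL on every input; nothing of Bałaban's asserted;
count-neutral. [cite: Balaban1989LargeFieldII, (0.1) p.356, (1.72) p.379, p.387, (1.98) p.390, p.391; Balaban1988Convergent, (2.49)–(2.50) p.264] -/
theorem uvIneq_at_record₁₃CoPH_of_gas_asym (Nc : ℕ) [NeZero Nc] (R : Repr172 (GaugeField (F.P P.K) k (SU N)) (tsys 4 Nc).Dom)
    {M₁ : ℝ} (hM : M₁ ≠ 0) (hnum : (Fintype.card (Site (F.P P.K) k) : ℝ) = (M₁ * Nc) ^ 4)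
    {κ₁ : ℝ} (hκ : B12TreeDecay.kappa₀ (4 * 2 ^ 4) (2 * 4) ≤ κ₁) (c : Fin 2 → ℝ)
    (hH : R.Holds (densOfRecord₁₃ F N θ.toStage13Params P k))
    (hχ01 : ∀ a V, 0 ≤ R.χ a V ∧ R.χ a V ≤ 1)
    (h0χ : ∀ V, R.χ R.allSmall V = chiβOfRecord₁₃ F N θ.toStage13Params P.K (gOfRecord₁₃ F N θ.toStage13Params P) k V)
    (hZ : ∀ a V, (R.TZ a).T 1 V ≤ ∏ X ∈ R.Zc a, Real.exp (-(c 0) - κ₁ * (tsys 4 Nc).dj X))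
    (hY : ∀ a V, (R.TYs a).T 1 V ≤ ∏ Y ∈ R.Ys a, Real.exp (-(c 1) - κ₁ * (tsys 4 Nc).dj Y))
    {LF DomY Cube Var Sv : Type*} [Fintype LF] [Fintype DomY] [Fintype Cube] [DecidableEq LF] [DecidableEq DomY]
    [DecidableEq Cube] {adjC : Cube → Cube → Prop} [DecidableRel adjC]
    (hrefl : ∀ a, adjC a a) (hsymm : ∀ a b, adjC a b → adjC b a)
    {locX : LF → Finset Cube} {locY : DomY → Finset Cube} {site : Var → Cube} (Yfix : R.Adm → Finset Cube)
    (houtX : ∀ a j, (locX j \ Yfix a).Nonempty) (houtY : ∀ a Y, (locY Y \ Yfix a).Nonempty)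
    (Op : R.Adm → Finset LF → ((Var → Sv) → ℂ) →+ ((Var → Sv) → ℂ))
    (hOps : ∀ a, LocalOps adjC locX (Yfix a) site (Op a))
    (hOpReal : ∀ a (S : Finset LF) (f : (Var → Sv) → ℂ), (∀ ψ, (f ψ).im = 0) → ∀ φ, (Op a S f φ).im = 0)
    (Vt : R.Adm → DomY → (Var → Sv) → ℂ) (hV : ∀ a Y, DepOn (Yfix a) site (Vt a Y) (locY Y))
    (hVreal : ∀ a Y ψ, (Vt a Y ψ).im = 0) (cfg : GaugeField (F.P P.K) k (SU N) → (Var → Sv))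
    {nbr : Cube → Finset Cube} (hnbr : ∀ a b, adjC a b → a ∈ nbr b) {νn : ℝ} (hν : ∀ b, ((nbr b).card : ℝ) ≤ νn)
    {d : R.Adm → Finset Cube → ℝ} {c₁ Rr κ₀ K₀ cv τ : ℝ} (hd : ∀ a X, 0 ≤ d a X) (hc₁ : 0 ≤ c₁) (hK₀ : 0 ≤ K₀)
    (hτ : 0 ≤ τ)
    (h197 : ∀ a V X, ‖F191 adjC locX locY (Yfix a) (mayerTerm (Op a) (Vt a) (cfg V)) X‖ ≤ c₁ * Real.exp (-(Rr * d a X)))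
    (h126 : ∀ a, Ineq126 (polys190 adjC locX locY (Yfix a)) (fun X => X \ Yfix a) (d a) κ₀ K₀)
    (hvol : ∀ a, VolBound (polys190 adjC locX locY (Yfix a)) (fun X => X \ Yfix a) (d a) cv)
    (hrate : κ₀ + τ * cv ≤ Rr) (hsmall : c₁ * Real.exp (τ * cv) * K₀ * νn ≤ τ)
    (hjunction : ∀ a V, R.curly a V = (bracket (Op a) (Vt a) (cfg V)).re)
    {πc : ℝ} (hQ : (Fintype.card Cube : ℝ) ≤ πc * (Fintype.card (Site (F.P P.K) k) : ℝ))
    (logT : GaugeField (F.P P.K) k (SU N) → ℝ) {CA cΓ cL cL' : ℝ} {Γ : ℕ → ℝ} (hCA : 0 ≤ CA)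
    (hΓ : ∑ n ∈ Icc 1 k, Γ n ≤ cΓ * (Fintype.card (Site (F.P P.K) k) : ℝ))
    (h249up : ∀ V, R.A' V + 1 / (gOfRecord₁₃ F N θ.toStage13Params P k) ^ 2 * wilsonBGOfRecord F N θ.εbg P k V - logT V ≤
      CA * ∑ n ∈ Icc 1 k, Γ n)
    (h249low : ∀ V, chiβOfRecord₁₃ F N θ.toStage13Params P.K (gOfRecord₁₃ F N θ.toStage13Params P) k V ≠ 0 →
      -(CA * ∑ n ∈ Icc 1 k, Γ n) ≤ R.A' V + 1 / (gOfRecord₁₃ F N θ.toStage13Params P k) ^ 2 * wilsonBGOfRecord F N θ.εbg P k V - logT V)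
    (hlog : ∀ V, chiβOfRecord₁₃ F N θ.toStage13Params P.K (gOfRecord₁₃ F N θ.toStage13Params P) k V ≠ 0 →
      -(cL * (Fintype.card (Site (F.P P.K) k) : ℝ)) ≤ logT V)
    (hlog' : ∀ V, logT V ≤ cL' * (Fintype.card (Site (F.P P.K) k) : ℝ)) :
    ∀ V : GaugeField (F.P P.K) k (SU N),
      B16.UVIneq ((datumOfRecord₁₃CoPH F N θ h).C P) k V (CA * cΓ + cL + πc * (c₁ * Real.exp (τ * cv) * K₀))
        (CA * cΓ + cL' + πc * (c₁ * Real.exp (τ * cv) * K₀) +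
          M₁⁻¹ ^ 4 * B12TreeDecay.K₀ (4 * 2 ^ 4) (2 * 4) * ∑ i, Real.exp (-(c i))) :=
  uvIneq_at_construction_of_gas_asym F N (coreOfRecord₁₃CoPH F N θ) (densOfRecord₁₃ F N θ.toStage13Params) P k Nc R hM hnum hκ c hH hχ01 h0χ hZ hY
    hrefl hsymm Yfix houtX houtY Op hOps hOpReal Vt hV hVreal cfg hnbr hν hd hc₁ hK₀ hτ h197 h126 hvol hrate hsmall hjunction hQ
    logT hCA hΓ h249up h249low hlog hlog' (fun V => wilsonBGOfRecord_nonneg F N θ.εbg P k V)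

end AtRecord

/-! ## §4. THE JUNCTION BY NAME: the upper (2.49) half at `V` FROM [III] THEOREM 2 AT THE RECORD (dag-n11-w2) at the background of record `U_k(V)` -/

section Junction

variable (F : T4Family) (N : ℕ) [NeZero N]
variable (θ : Stage13HParams F N) (P : B12.RunParams) (k : ℕ)

/-- The Wilson term of [III] Theorem 2's record sentence at the background of record IS the Cor.-3 chain's: `wilsonAction4 (U_k(V)) = wilsonBGOfRecord F N ε P k V` (`rfl`, def-R's
`Node00.wilsonBGOfRecord`). [cite: Balaban1987RG1, (0.22) p.256 (bookkeeping)] -/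
theorem wilsonAction4_Uk_eq_wilsonBGOfRecord (ε : ℝ) (V : GaugeField (F.P P.K) k (SU N)) :
    wilsonAction4 (Uk F N P.K k ε V) = wilsonBGOfRecord F N ε P k V := rfl

/-- **★★ THE UPPER (2.49) HALF AT `V` IN THE COR.-3 CHAIN's CURRENCY, FROM [III] THEOREM 2's SENTENCES AT THE RECORD** (dag-n11-w2's `action23_at_record₁₃CoPH_le_of_thm2` evaluated
at `U := U_k(V) = Node00.Uk F N P.K k θ.εbg V`, its Wilson term read as `wilsonBGOfRecord` by `rfl`), UNDER ONE DISPLAYED IDENTIFICATION `hA'eq`: «the (1.72) representation's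
completed action `R.A′` at `V` IS print's (2.23) action of record `action23 k (U_k(V))` along the history `s` with term-value witness `t`, fluctuation argument `a`, constant `E_k`».
Binders (dag-n11-w2's, VERBATIM at that `U`): the history `s`, `t`, `a`, `κ₀ ≥ 7`, `E_k = EkLog + EkRest`, constants `E₁ R₁ B₁ L β E₂`, volumes `Γ ≥ 0`, `β_j ≥ 0` (`hβj`),
`φ_j ≤ 1` (`hφ`), (2.43)_j (`h243`), (2.44)_j (`h244` — THE LARGE-FIELD 𝐑-OPERATION SENTENCE), (2.46)'s coupling inputs (`hsum`, `hsmall`), (2.48) (`h248`), the vacuum sentence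
(`hvac`).  Conclusion = §3's `h249up` AT `V` with `logT V := −EkLog`, `C := E₁(1−L^{−β})⁻¹ + 1 + 2B₁ + E₂`.  Thm 2 NOT proved; `hA'eq` is the object-level seam (what `R` is), displayed.
[cite: Balaban1988Convergent, Thm 2 (2.43)–(2.44) p.263, (2.45)–(2.49) pp.263–264, (2.24) p.259; Balaban1989LargeFieldII, (1.72) p.379 (bookkeeping)] -/
theorem ineq249up_at_record₁₃CoPH_of_thm2_of_aPrimeEq {Dom : Type*} (R : Repr172 (GaugeField (F.P P.K) k (SU N)) Dom)
    (V : GaugeField (F.P P.K) k (SU N))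
    (s : SeqOfRecord F θ.ν θ.τ9.M (gOfRecord₁₃ F N θ.toStage13Params P) P.K k)
    (t : Sect2.TermValues (F.P P.K) (MatA N) (FluctV N) θ.τ9.M) (a : Tk.SFluct (F.P P.K) (FluctV N)) (κ₀ : ℕ) (hκ : 7 ≤ κ₀)
    (Ek EkLog EkRest : ℝ) (hEk : Ek = EkLog + EkRest) (E₁ R₁ B₁ L β E₂ : ℝ) (Γ : ℕ → ℝ)
    (hL : 1 < L) (hβ : 0 < β) (hE : 0 ≤ E₁) (hR : 0 ≤ R₁) (hΓ : ∀ n, 1 ≤ n → n ≤ k → 0 ≤ Γ n)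
    (hβj : ∀ j, 1 ≤ j → j ≤ k → 0 ≤ 1 / gOfRecord₁₃ F N θ.toStage13Params P (j - 1) ^ 2 - 1 / gOfRecord₁₃ F N θ.toStage13Params P j ^ 2)
    (hφ : ∀ j, 1 ≤ j → j ≤ k → ∀ x, θ.Phih P k s.Ω s.Λ j x ≤ 1)
    (h243 : ∀ j, 1 ≤ j → j ≤ k →
      |EjSub (sect2TowerOfRecord F N (FluctV N) P.K (settingOfRecord₁₃ F N θ.toStage13Params P) (θ.rzAt P s) s t)
            (fun j X z => Sect2.admE (F.P P.K) θ.ν θ.τ9.M (gOfRecord₁₃ F N θ.toStage13Params P) s.Λ j (Sect2.domSites (F.P P.K) θ.τ9.M j X) z) j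
            (Uk F N P.K k θ.εbg V)
          - (1 / gOfRecord₁₃ F N θ.toStage13Params P (j - 1) ^ 2 - 1 / gOfRecord₁₃ F N θ.toStage13Params P j ^ 2) *
              smearedWilson (θ.Phih P k s.Ω s.Λ j) (Uk F N P.K k θ.εbg V)| ≤ E₁ * ∑ n ∈ Icc j k, (L ^ ((j : ℝ) - n)) ^ β * Γ n)
    (h244 : ∀ j, 1 ≤ j → j ≤ k →
      |∑ X : (Sect2.domSys (F.P P.K) θ.τ9.M j).Dom, (if Sect2.admR (F.P P.K) θ.ν θ.τ9.M (gOfRecord₁₃ F N θ.toStage13Params P) s.Λ j (Sect2.domSites (F.P P.K) θ.τ9.M j X) then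
          ((t.R j X (Sect2.ofBackgroundC (ιSU N) (Uk F N P.K k θ.εbg V))).re - (t.R j X (Sect2.ofBackgroundC (ιSU N) 1)).re) else 0)| ≤
        R₁ * (gOfRecord₁₃ F N θ.toStage13Params P j) ^ κ₀ * ∑ n ∈ Icc j k, Γ n)
    (hsum : ∀ n, 1 ≤ n → n ≤ k → ∑ j ∈ Icc 1 n, (gOfRecord₁₃ F N θ.toStage13Params P j) ^ κ₀ ≤ (gOfRecord₁₃ F N θ.toStage13Params P n) ^ (κ₀ - 6))
    (hsmall : ∀ n, 1 ≤ n → n ≤ k → R₁ * (gOfRecord₁₃ F N θ.toStage13Params P n) ^ (κ₀ - 6) ≤ 1)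
    (h248 : |B240 (sect2TowerOfRecord F N (FluctV N) P.K (settingOfRecord₁₃ F N θ.toStage13Params P) (θ.rzAt P s) s t)
        (fun j X => Sect2.admB (F.P P.K) θ.ν θ.τ9.M (gOfRecord₁₃ F N θ.toStage13Params P) s.Ω s.Λ j (Sect2.domSites (F.P P.K) θ.τ9.M j X)) a k
        (Uk F N P.K k θ.εbg V)| ≤ 2 * B₁ * ∑ n ∈ Icc 1 k, Γ n)
    (hvac : VacuumRestBound EkRest E₂ Γ k)
    (hA'eq : R.A' V =
      (sect2ActionDataOfRecord F N (FluctV N) P.K (settingOfRecord₁₃ F N θ.toStage13Params P) (θ.rzAt P s) s t a Ek).action23 k (Uk F N P.K k θ.εbg V)) :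
    R.A' V + 1 / (gOfRecord₁₃ F N θ.toStage13Params P k) ^ 2 * wilsonBGOfRecord F N θ.εbg P k V - (-EkLog) ≤
      (E₁ * (1 - L ^ (-β))⁻¹ + 1 + 2 * B₁ + E₂) * ∑ n ∈ Icc 1 k, Γ n := by
  have hle := action23_at_record₁₃CoPH_le_of_thm2 θ P s t a κ₀ hκ Ek EkLog EkRest hEk (Uk F N P.K k θ.εbg V) E₁ R₁ B₁ L β E₂ Γ hL hβ hE hR hΓ
    hβj hφ h243 h244 hsum hsmall h248 hvac
  rw [hA'eq, ← wilsonAction4_Uk_eq_wilsonBGOfRecord F N P k θ.εbg V]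
  linarith

end Junction

end Summit.QuantumFields.YangMills.BalabanUVNodes.N13Cor3AsymJunctionAtRecord13CoPH

end
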